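import Summits.QuantumFields.YangMills.Theorems.UnitScaleTiltProp7CurvedMemberBallLetters
import Summits.QuantumFields.YangMills.Theorems.UnitScaleTiltProp7GaugeCovariancePointwise
import Summits.QuantumFields.YangMills.Theorems.UnitScaleTiltProp7CurvedMemberLocalGradient
import Summits.QuantumFields.YangMills.Theorems.UnitScaleTiltProp7WeightedGradientAbsorption
import Summits.QuantumFields.YangMills.Theorems.UnitScaleTiltProp7ComplementaryProjectorBlockDecay
import HarnessLib

/-!
# Route `UnitScaleTilt`, crux K1 «MinimiserStabilityRegPr» (stmt-QuantumFields-19200), EX face — (L3′b)-GRAD FILE **(G1-3b)(ii): THE CURVED MEMBER GRADIENT ROW — V6's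
# `hDcol` FROM THE COLUMN'S VALUE LETTERS**, the per-bond discharge of ✓`Prop7WeightedGradientAbsorption.hDcol_of_perBond`'s `hloc`∕`hm`∕`hmargin` (px12 g15 (i), ✓p763767)
# through: the torus axial gauge `V := U₀^{axialT U₀ b.src}` and its conjugation isometries `Φ`∕`Ψ` (px10 g12 ✓`Prop7GaugeCovariancePointwise.exists_adIsometries_pointwise`:
# pointwise isometry, the three intertwinings, the reverse η-gradient row), the local knit (G1-3a) (px12 g15 ✓p763385 `exists_curved_localGradient`) fed with the
# chart-glue background rows (G-δ)∕(G-Θ) (px19 g13 ✓p763682) and the ball letters (ii-a) (✓`Prop7CurvedMemberBallLetters`), and the read-back ✓`norm_DL2_le`.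
# ★p1 g25 CHAIR WORDS №7∕№8 («(G1-3)'s OUTPUT SHAPE BY NAME = V6's `hDcol`»); px12 g15's (ii) SPEC 06:21Z; px19 g13 LOCATE 06:27Z.

Cell `ym3-torus` (YM ladder rung R3 = continuum SU(2) Yang–Mills on T³ — a RUNG, NOT the Clay problem: not d = 4, not infinite volume, not a mass gap);
width seat `ym3-torus-px19` (gen 13); helper `--supports stmt-QuantumFields-19200`.  THEOREMS ONLY (0 `def`, 0 `sorry`, default heartbeats).

THE MATHEMATICS ([Balaban1985BackgroundPropagators] Thm 3.1 (3.42)–(3.44): local estimates on cubes (3.45)–(3.47), then the exponentially weighted sup).  For the LOD column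
`u = ψ_{y,Y} = G(T(ι(δ_y ⊗ Y)))` (`Δ^η_{U₀}u = T(ι(δ_y⊗Y)) − a•T(ι(Q″u))` by `hAG`) and a bond `b`, put `c := b.src`, `x := e c`, `V := U₀^{σ}`, `σ := axialT U₀ c`.  Transport:
`Δ^η_V(Φu) + Φ(q − f) = D*_V 0`; VALUE on the `12ℓ+4` sup-ball: `‖(Φu)(z)‖ = ‖u(z)‖ ≤ C_pt·e^{51κ}·e^{−κ d(B c, y)}‖Y‖ =: M_u` (letter `hcol` + the slack); `M_q` likewise
(letters `hpen`, `hsrc` + one-block support of the source); `‖V − 1‖ ≤ δ`, `ℓδ ≤ 48ε₀`; `Θ`, `ℓΘ ≤ 4ε₀(3 + 2457C)`; the η-GRADIENT LETTER `G := G_b + 2√2·(ℓδ)·M_u` from the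
input-ball bound `G_b` on the gauge-invariant covariant gradient (`‖(D_V Φu)(z,μ)‖ = ‖(D_{U₀}u)(z,μ)‖ = g(b′)`, `b′ = ⟨e⁻¹z, μ⟩` within coarse distance `51`); (G1-3a) at
`(V, Φu, Φ(q−f), 0, x)`; read-back `g(b) = ‖(D_V Φu)(x, b.dir)‖ ≤ ℓ‖Φu(x+e) − Φu(x)‖ + 2√2(ℓδ)M_u`.  Result: `g(b) ≤ m(b) + C_g·a₁·G_b`, `a₁ = 48ε₀(6√20 + 6√2)`,
`m(b) = M·‖Y‖·e^{−κ d(B b.src, y)}` — i.e. `hloc`∕`hm` with `(C_g, a, M) := (1, C_g·a₁, M)`, and `hmargin` is the displayed smallness `C_g·a₁·e^{51κ} ≤ ½` of `ε₀`.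

WHAT IS PROVED (ns `Summit.QuantumFields.YangMills.Theorems.Prop7CurvedMemberGradientRow`; V6's letters `hseq hι hT G hAG` VERBATIM; the column's VALUE letters `hcol` (= V5's, inhabited by
V4 ✓p762742), `hpen` (inhabited by V4a ✓`norm_equiv_penalty_column_le` with `A_pen ↦ A·e^{3μ}`, `κ ≤ μ`), `hsrc` (inhabited by V2b ✓`norm_equiv_column_source_le`)).
* §1 ★★ `perBond_gradient_le` — THE PER-BOND LOCAL LETTER: for every `y Y b` and every bound `G_b` of `g` on the bonds within coarse distance `51` of `b`,
  `g(b) ≤ M·‖Y‖·e^{−κ d(B b.src, y)} + C_g·a₁·G_b` (`C_g := (G1-3a)'s constant`, `C := (★)'s`, both as `Exists.choose` of the landed closed theorems — K-free by construction).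
* §2 ★★★ `column_gradient_decay` — V6's `hDcol` BY TEXT: `‖(D_{U₀}ψ_{y,Y})(b)‖ ≤ (2M)·e^{−κ·d(B b.src, y)}·‖Y‖` for all `y Y b`, under `hroom` (no wrap at `R = 12ℓ+4`) and `hsmall`.
* (ii-c) ✓`Prop7CurvedMemberGradientRowOfRegPr.column_gradient_decay_of_regPr` (next file) discharges `hcol`∕`hpen`∕`hsrc` from V4∕V4a∕V2b BY NAME at `κ := min μ ¼ ∕ 2`.
HYP-SAT (★★OWNER RULING №42).  `RegPr` (both clauses, the EX face's standing hypothesis), V6's LOD letters (⟸ ✓`exists_intertwiner_of_regPr`, ✓`exists_massive_inverse`), the three VALUE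
letters (inhabited BY NAME as said; DOORFIT cert on HOME), `hroom` (no-wrap room `2(12·L^{K−n} + 5) ≤ sitesPerDir 0` — TRUE for large members, via the COVER for small ones, CHAIR WORD
№1 class), `hsmall` (print's smallness of `ε₀` against the universal `C_g`: K-FREE).  The conclusion is V6's `hDcol` with an explicit constant; no `Prop`-valued hypothesis restates it.
HONEST SCOPE.  Composition of landed rows; nothing of V6's §3, `h349`, `hPcol`, the ten EX rows, `hT`, `hGF`, EX `stub_existenceMinimalOrbit`, `MinimiserStabilityRegPr` (19200) or the
rung `YM3TorusSU2` is proved here; the Yang–Mills mass gap is NOT proved.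

References: T. Bałaban, CMP **99** (1985) 389–434 [Balaban1985BackgroundPropagators] ((3.3) p.391, (3.23)–(3.24) p.394, Thm 3.1 (3.42)–(3.47) pp.397–398, (3.49) p.399);
CMP **98** (1985) 17–51 [Balaban1985Averaging] ((19) p.21, pp.24–25); CMP **102** (1985) 277–309 [Balaban1985Variational] ((2), (8) p.278).
-/

set_option autoImplicit false

noncomputable section

open scoped BigOperators Matrix.Norms.L2Operator InnerProductSpace ComplexConjugate

namespace Summit.QuantumFields.YangMills.Theorems.Prop7CurvedMemberGradientRow

open Literature.MathematicalPhysics.QuantumFieldTheory.Balaban1983to89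
open Literature.MathematicalPhysics.QuantumFieldTheory.Balaban1983to89.T3ContinuumYM3Torus
open T4Continuum BlockAveraging
open BlockAveraging (Idx)
open B7Prop1Explicit (disp)
open B5Eq118OneStroke (iterBlockOf)
open B10Eq27TorusAxialLog (holT transl axialT)
open B7TransferAnalyticMean (meanCLM)
open B4Sect5Torus (TSite tdist tdist_triangle tdist_self tdist_nonneg)
open B9SectCLatticeCarrier (Bond shift tdist_shift_le)
open B9Eq311L2Pairing (WL2)
open B11Eq103H1Complex (SiteL2K BondL2K)
open B3Taylor310LocalRemainder (tdist_self)
open Summit.QuantumFields.YangMills.Theorems.Prop8Chart (emlIterU)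
open T3SectALandauChart (bgUnits)
open T3RegularMinimiser (regThreshold)
open T3PrintedRegularMinimiser (RegPr)
open T3PrintedRegularOrbits (sites_eq)
open T3LevelShift (siteShift)
open Summit.QuantumFields.YangMills.Theorems.Prop7SectET3Transport (periodsT3 siteEquiv bondEquiv bondEquiv_apply bgOfCfg)
open Summit.QuantumFields.YangMills.Theorems.Prop7SectET3HilbertLetters (W₂ toL2S DL2 DstarL2 covLapSite toL2S_apply)
open Summit.QuantumFields.YangMills.Theorems.Prop7TwoBackgroundGradientComparison (one_le_periodsT3 norm_DL2_le)
open Summit.QuantumFields.YangMills.Theorems.Prop7ComplementaryProjectorBlockDecay (inner_lift_eq_zero_of_disjoint)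
open Summit.QuantumFields.YangMills.Theorems.Prop7TopMeanAdjointBlockLocal (adjoint_apply_eq_zero_off_block)
open Summit.QuantumFields.YangMills.Theorems.Prop7CurvedMemberLocalGradient (exists_curved_localGradient)
open Summit.QuantumFields.YangMills.Theorems.Prop7WeightedGradientAbsorption (hDcol_of_perBond)
open Summit.QuantumFields.YangMills.Theorems.Prop7GaugeCovariancePointwise (exists_adIsometries_pointwise ell_mul_norm_sub_le_of_rows covLapSite_gaugeAct_eq_of_eq)
open Summit.QuantumFields.YangMills.Theorems.AxialGaugeChartGlue (norm_bgOfCfg_axialT_sub_le)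
open Summit.QuantumFields.YangMills.Theorems.Prop7CurvedMemberBallLetters (natCast_radius tdist_iterBlockOf_le_of_ball decay_on_ball norm_sub_le_on_ball
  norm_bgOfCfg_axialT_sub_one_le_of_ball ell_mul_delta_ball_le ell_mul_theta_ball_le)

variable (F : T3Family) {n K : ℕ} (h : n ≤ K) {c₀ c₁ : ℝ} [Fact (0 < c₀)] [Fact (0 < c₁)]
  {ε₀ : ℝ} (hε₀ : 0 < ε₀) (hε1 : ε₀ ≤ 1)
  (U₀ : GaugeField (F.P K) 0 (Matrix.specialUnitaryGroup (Fin 2) ℂ)) (hreg : RegPr F n K ε₀ U₀)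
  (Q'' : SiteL2K ℂ 3 (periodsT3 F K) c₀ W₂ →ₗ[ℂ] (Site (F.P K) (K - n) → Matrix (Fin 2) (Fin 2) ℂ))
  (hseq : ∀ lam : Site (F.P K) 0 → Matrix (Fin 2) (Fin 2) ℂ, ∃ ns : (j : ℕ) → Site (F.P K) j → Matrix (Fin 2) (Fin 2) ℂ, ns 0 = lam ∧
      (∀ (j : ℕ) (y : Site (F.P K) (j + 1)), ns (j + 1) y = ns j (emb y) - meanCLM (Idx (F.P K)) (Matrix (Fin 2) (Fin 2) ℂ) fun i : Idx (F.P K) =>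
        ns j (emb y) - ((holT (emlIterU j (bgUnits F K U₀)) (emb y) (stairWord i.2.1 (off i.1)) : (Matrix (Fin 2) (Fin 2) ℂ)ˣ) : Matrix (Fin 2) (Fin 2) ℂ) *
          ns j (transl (emb y) (disp (stairWord i.2.1 (off i.1)))) * (((holT (emlIterU j (bgUnits F K U₀)) (emb y) (stairWord i.2.1 (off i.1)))⁻¹ : (Matrix (Fin 2) (Fin 2) ℂ)ˣ) : Matrix (Fin 2) (Fin 2) ℂ)) ∧
      ns (K - n) = Q'' (toL2S F K c₀ lam))
  (ι : (Site (F.P K) (K - n) → Matrix (Fin 2) (Fin 2) ℂ) →ₗ[ℂ] SiteL2K ℂ 3 (periodsT3 F n) c₁ W₂)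
  (hι : ∀ c, ι c = toL2S F n c₁ (fun z => c (siteShift (sites_eq F n K h) z)))
  (T : SiteL2K ℂ 3 (periodsT3 F n) c₁ W₂ →ₗ[ℂ] SiteL2K ℂ 3 (periodsT3 F K) c₀ W₂)
  (hT : ∀ (l : SiteL2K ℂ 3 (periodsT3 F K) c₀ W₂) (f : SiteL2K ℂ 3 (periodsT3 F n) c₁ W₂), ⟪ι (Q'' l), f⟫_ℂ = ⟪l, T f⟫_ℂ)
  (a : ℝ)
  (G : SiteL2K ℂ 3 (periodsT3 F K) c₀ W₂ →ₗ[ℂ] SiteL2K ℂ 3 (periodsT3 F K) c₀ W₂)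
  (hAG : ∀ f, covLapSite F n K c₀ U₀ (G f) + (a : ℂ) • T (ι (Q'' (G f))) = f)


/-! ## §0 The regrouping of the (G1-3a) bracket (pure real algebra) -/

omit [Fact (0 < c₀)] [Fact (0 < c₁)] in
/-- The (G1-3a) bracket at `M_f = H_f := 0`, `G := G_b + 2√2·dℓ·M_u`, plus the read-back term `2√2·(ℓδ)·M_u`, with `ℓδ ≤ dℓ`, `ℓΘ ≤ tℓ`, is at most
`C_g·(M_u·(2 + 2√2·tℓ + (12·√2²·√10 + 24·√2²)·dℓ²) + M_q) + 2√2·dℓ·M_u + C_g·dℓ·(6√2√10 + 6√2)·G_b` (all letters nonnegative). [folklore] -/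
theorem regroup_bracket {Cg Mu Mq Gb lδ lΘ dℓ tℓ : ℝ} (hCg : 0 ≤ Cg) (hMu : 0 ≤ Mu) (hGb : 0 ≤ Gb)
    (hlδ0 : 0 ≤ lδ) (hlΘ0 : 0 ≤ lΘ) (hlδ : lδ ≤ dℓ) (hlΘ : lΘ ≤ tℓ) :
    Cg * (Mu + (0 + 2 * Real.sqrt 2 * (lΘ * Mu + lδ * (3 * Real.sqrt 10 * (Gb + 2 * Real.sqrt 2 * dℓ * Mu))))
        + (6 * Real.sqrt 2 * lδ * (0 + (Gb + 2 * Real.sqrt 2 * dℓ * Mu) + 2 * Real.sqrt 2 * lδ * Mu) + Mu + Mq))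
      + 2 * Real.sqrt 2 * dℓ * Mu
      ≤ (Cg * (Mu * (2 + 2 * Real.sqrt 2 * tℓ + (24 * Real.sqrt 10 + 48) * dℓ ^ 2) + Mq) + 2 * Real.sqrt 2 * dℓ * Mu)
        + Cg * (dℓ * (6 * Real.sqrt 2 * Real.sqrt 10 + 6 * Real.sqrt 2)) * Gb := by
  have hdℓ0 : 0 ≤ dℓ := hlδ0.trans hlδ
  have htℓ0 : 0 ≤ tℓ := hlΘ0.trans hlΘ
  have hs2 : Real.sqrt 2 * Real.sqrt 2 = 2 := Real.mul_self_sqrt (by norm_num)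
  have hmono : Cg * (Mu + (0 + 2 * Real.sqrt 2 * (lΘ * Mu + lδ * (3 * Real.sqrt 10 * (Gb + 2 * Real.sqrt 2 * dℓ * Mu))))
        + (6 * Real.sqrt 2 * lδ * (0 + (Gb + 2 * Real.sqrt 2 * dℓ * Mu) + 2 * Real.sqrt 2 * lδ * Mu) + Mu + Mq))
      + 2 * Real.sqrt 2 * dℓ * Mu
      ≤ Cg * (Mu + (0 + 2 * Real.sqrt 2 * (tℓ * Mu + dℓ * (3 * Real.sqrt 10 * (Gb + 2 * Real.sqrt 2 * dℓ * Mu))))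
        + (6 * Real.sqrt 2 * dℓ * (0 + (Gb + 2 * Real.sqrt 2 * dℓ * Mu) + 2 * Real.sqrt 2 * dℓ * Mu) + Mu + Mq))
      + 2 * Real.sqrt 2 * dℓ * Mu := by
    gcongr
  refine hmono.trans (le_of_eq ?_)
  linear_combination ((12 * Real.sqrt 10 + 24) * dℓ ^ 2 * Cg * Mu) * hs2

/-! ## §1 The per-bond local letter -/

include h hε₀ hε1 hreg hseq hι hT hAG in
/-- ★★ **THE PER-BOND LOCAL GRADIENT LETTER** (`hloc` ∧ `hm` of ✓`hDcol_of_perBond` for the LOD column, discharged).  With `C_g := (G1-3a)'s constant`, `C := (★)'s`, the value letters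
`hcol`∕`hpen`∕`hsrc` at rate `κ ≥ 0`, no wrap at `R = 12ℓ + 4`: for every coarse `y`, fibre value `Y`, bond `b` and every bound `G_b` of `g(b′) := ‖(D_{U₀}ψ_{y,Y})(b′)‖` over the
bonds `b′` with `d(B b.src, B b′.src) ≤ 51`:
`g(b) ≤ M·‖Y‖·e^{−κ·d(B b.src, y)} + C_g·(48ε₀(6√20 + 6√2))·G_b`,
`M := C_g·(C_pt·e^{51κ}·(2 + 2√2·4ε₀(3 + 2457C) + (24√10 + 48)(48ε₀)²) + (A_pen + A_src)·e^{51κ}) + 2√2·48ε₀·C_pt·e^{51κ}`.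
[cite: Balaban1985BackgroundPropagators, Thm 3.1 (3.42)–(3.47) pp.397–398; Balaban1985Averaging, pp.24–25] -/
theorem perBond_gradient_le {Cpt Apen Asrc κ : ℝ} (hCpt : 0 ≤ Cpt) (hApen : 0 ≤ Apen) (hAsrc : 0 ≤ Asrc) (hκ : 0 ≤ κ)
    (hcol : ∀ (y : Site (F.P K) (K - n)) (Y : Matrix (Fin 2) (Fin 2) ℂ) (x : Site (F.P K) 0),
      ‖WL2.equiv ℂ _ W₂ (G (T (ι (Pi.single y Y)))) (siteEquiv F K x)‖ ≤ Cpt * Real.exp (-(κ * (Site.tdist (P := F.P K) (iterBlockOf (K - n) x) y : ℝ))) * ‖Y‖)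
    (hpen : ∀ (y : Site (F.P K) (K - n)) (Y : Matrix (Fin 2) (Fin 2) ℂ) (x : Site (F.P K) 0),
      ‖WL2.equiv ℂ _ W₂ ((a : ℂ) • T (ι (Q'' (G (T (ι (Pi.single y Y))))))) (siteEquiv F K x)‖
        ≤ Apen * Real.exp (-(κ * (Site.tdist (P := F.P K) (iterBlockOf (K - n) x) y : ℝ))) * ‖Y‖)
    (hsrc : ∀ (y : Site (F.P K) (K - n)) (Y : Matrix (Fin 2) (Fin 2) ℂ) (xt : TSite 3 (periodsT3 F K)),
      ‖WL2.equiv ℂ _ W₂ (T (ι (Pi.single y Y))) xt‖ ≤ Asrc * ‖Y‖)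
    (hroom : 2 * (12 * F.L ^ (K - n) + 5) ≤ (F.P K).sitesPerDir 0)
    (y : Site (F.P K) (K - n)) (Y : Matrix (Fin 2) (Fin 2) ℂ) (b : PBond (F.P K) 0) (Gb : ℝ)
    (hGb : ∀ b' : PBond (F.P K) 0, (Site.tdist (P := F.P K) (iterBlockOf (K - n) b.src) (iterBlockOf (K - n) b'.src) : ℝ) ≤ 51 →
      ‖WL2.equiv ℂ _ W₂ (DL2 F n K c₀ U₀ (G (T (ι (Pi.single y Y))))) (bondEquiv F K b')‖ ≤ Gb) :
    ‖WL2.equiv ℂ _ W₂ (DL2 F n K c₀ U₀ (G (T (ι (Pi.single y Y))))) (bondEquiv F K b)‖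
      ≤ (exists_curved_localGradient.choose *
            (Cpt * Real.exp (51 * κ) * (2 + 2 * Real.sqrt 2 * (4 * ε₀ * (3 + 2457 * norm_bgOfCfg_axialT_sub_le.choose))
              + (24 * Real.sqrt 10 + 48) * (48 * ε₀) ^ 2) + (Apen + Asrc) * Real.exp (51 * κ))
          + 2 * Real.sqrt 2 * (48 * ε₀) * (Cpt * Real.exp (51 * κ))) * ‖Y‖ * Real.exp (-(κ * (Site.tdist (P := F.P K) (iterBlockOf (K - n) b.src) y : ℝ)))
        + exists_curved_localGradient.choose * (48 * ε₀ * (6 * Real.sqrt 2 * Real.sqrt 10 + 6 * Real.sqrt 2)) * Gb := by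
  classical
  -- the two universal constants
  obtain ⟨hCg0, hG13a⟩ := exists_curved_localGradient.choose_spec
  set Cg : ℝ := exists_curved_localGradient.choose with hCg
  obtain ⟨hC0, hΘrow⟩ := norm_bgOfCfg_axialT_sub_le.choose_spec
  set C : ℝ := norm_bgOfCfg_axialT_sub_le.choose with hCdef
  clear_value Cg C
  -- scales and radius
  have hP1 : ∀ i, 1 ≤ periodsT3 F K i := one_le_periodsT3 F K
  have hL1 : (1 : ℝ) ≤ (F.L : ℝ) := by have := F.hL.2; exact_mod_cast this.le
  have hℓ1 : (1 : ℝ) ≤ (F.L : ℝ) ^ (K - n) := one_le_pow₀ hL1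
  have hℓ0 : (0 : ℝ) < (F.L : ℝ) ^ (K - n) := by positivity
  set R : ℕ := 12 * F.L ^ (K - n) + 4 with hRdef
  have hRℝ : (R : ℝ) = 12 * (F.L : ℝ) ^ (K - n) + 4 := natCast_radius F n K
  have hroom' : 2 * (R + 1) ≤ (F.P K).sitesPerDir 0 := by rw [hRdef]; omega
  have hε0 : 0 ≤ ε₀ := hε₀.le
  -- the bond, the gauge, the isometries
  set c : Site (F.P K) 0 := b.src with hc
  set x : TSite 3 (periodsT3 F K) := siteEquiv F K c with hx
  set V : GaugeField (F.P K) 0 (Matrix.specialUnitaryGroup (Fin 2) ℂ) := GaugeField.gaugeAct (axialT U₀ c) U₀ with hV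
  obtain ⟨Φ, Ψ, -, -, hP1Φ, -, hU⟩ := exists_adIsometries_pointwise F n K c₀ (axialT U₀ c)
  obtain ⟨-, -, hΔ, hDpt, -, -⟩ := hU U₀
  -- the column, its source, its penalty, its equation and the transported equation
  set u : SiteL2K ℂ 3 (periodsT3 F K) c₀ W₂ := G (T (ι (Pi.single y Y))) with hu
  set fs : SiteL2K ℂ 3 (periodsT3 F K) c₀ W₂ := T (ι (Pi.single y Y)) with hfs
  set qp : SiteL2K ℂ 3 (periodsT3 F K) c₀ W₂ := (a : ℂ) • T (ι (Q'' u)) with hqp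
  have hueq : covLapSite F n K c₀ U₀ u = fs - qp := by
    rw [hqp, hfs, ← hAG (T (ι (Pi.single y Y)))]; abel
  have htrans : covLapSite F n K c₀ V (Φ u) + Φ (qp - fs) = DstarL2 F n K c₀ V 0 := by
    rw [hV, covLapSite_gaugeAct_eq_of_eq F n K c₀ (axialT U₀ c) U₀ Φ hΔ hueq, ← map_add, sub_add_sub_cancel, sub_self, map_zero, map_zero]
  -- the decay factor and the slack
  set Ed : ℝ := Real.exp (-(κ * (Site.tdist (P := F.P K) (iterBlockOf (K - n) c) y : ℝ))) with hEd
  set Sκ : ℝ := Real.exp (51 * κ) with hSκ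
  have hEd0 : 0 < Ed := Real.exp_pos _
  have hSκ0 : 0 < Sκ := Real.exp_pos _
  -- VALUE on the big ball
  set Mu : ℝ := Cpt * ‖Y‖ * Sκ * Ed with hMu
  have hMu0 : 0 ≤ Mu := by positivity
  have hMuBall : ∀ z, tdist (periodsT3 F K) x z ≤ 12 * (F.L : ℝ) ^ (K - n) + 4 →
      ‖WL2.equiv ℂ (fun _ : TSite 3 (periodsT3 F K) => c₀) W₂ (Φ u) z‖ ≤ Mu := by
    intro z hz
    rw [hP1Φ]
    exact decay_on_ball F n K (f := fun t => ‖WL2.equiv ℂ (fun _ : TSite 3 (periodsT3 F K) => c₀) W₂ u t‖) (A := Cpt * ‖Y‖) (by positivity) hκ y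
      (fun x' => (hcol y Y x').trans_eq (by ring)) c z hz
  -- SOURCE∕PENALTY on the big ball
  set Mq : ℝ := (Apen * ‖Y‖ + Asrc * ‖Y‖) * Sκ * Ed with hMq
  have hMq0 : 0 ≤ Mq := by positivity
  have hfs0 : ∀ x' : Site (F.P K) 0, iterBlockOf (K - n) x' ≠ y → WL2.equiv ℂ (fun _ : TSite 3 (periodsT3 F K) => c₀) W₂ fs (siteEquiv F K x') = 0 := by
    intro x' hx'
    have hz := adjoint_apply_eq_zero_off_block F U₀ Q'' hseq ι (inner_lift_eq_zero_of_disjoint F h ι hι) T hT (Pi.single y Y) y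
      (fun y' hy' => Pi.single_eq_of_ne hy' _) x' hx'
    have hfs' : fs = toL2S F K c₀ ((toL2S F K c₀).symm fs) := ((toL2S F K c₀).apply_symm_apply fs).symm
    rw [hfs', toL2S_apply, Equiv.symm_apply_apply, hfs, hz, map_zero]
  have hMqBall : ∀ z, tdist (periodsT3 F K) x z ≤ 12 * (F.L : ℝ) ^ (K - n) + 4 →
      ‖WL2.equiv ℂ (fun _ : TSite 3 (periodsT3 F K) => c₀) W₂ (Φ (qp - fs)) z‖ ≤ Mq := by
    intro z hz
    rw [hP1Φ]
    exact norm_sub_le_on_ball F n K c₀ qp fs (Apen := Apen * ‖Y‖) (Asrc := Asrc * ‖Y‖) (by positivity) (by positivity) hκ y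
      (fun x' => (hpen y Y x').trans_eq (by ring)) (fun xt => hsrc y Y xt) hfs0 c z hz
  -- the background rows of `V` : `δ` on the big ball, `Θ` on the `4ℓ`-ball
  set δ : ℝ := 3 * (R : ℝ) * regThreshold F n K ε₀ with hδdef
  have hδ0 : 0 ≤ δ := by rw [hδdef]; unfold regThreshold; positivity
  have hδBall : ∀ (z : TSite 3 (periodsT3 F K)) (μ : Fin 3), tdist (periodsT3 F K) x z ≤ 12 * (F.L : ℝ) ^ (K - n) + 4 →
      ‖((bgOfCfg F K V (z, μ) : (Matrix (Fin 2) (Fin 2) ℂ)ˣ) : Matrix (Fin 2) (Fin 2) ℂ) - 1‖ ≤ δ := by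
    intro z μ hz
    exact norm_bgOfCfg_axialT_sub_one_le_of_ball F n K hε0 U₀ hreg.1 c hroom' z μ (by rw [hRℝ]; exact hz)
  have hℓδ : (F.L : ℝ) ^ (K - n) * δ ≤ 48 * ε₀ := by rw [hδdef]; exact ell_mul_delta_ball_le F n K hε0
  set Θ : ℝ := (3 * (ε₀ * ((F.L : ℝ)⁻¹) ^ (2 * (K - n))) + (3 : ℝ) ^ 2 * (C * ((ε₀ * ((F.L : ℝ)⁻¹) ^ (2 * (K - n))) +
      R * (ε₀ * ((F.L : ℝ)⁻¹) ^ (3 * (K - n))) + (R : ℝ) ^ 2 * (ε₀ * ((F.L : ℝ)⁻¹) ^ (2 * (K - n))) ^ 2))) * Real.sqrt ((R : ℝ) * (F.L : ℝ) ^ (K - n)) with hΘdef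
  have hΘ0 : 0 ≤ Θ := by
    have : (0 : ℝ) ≤ ((F.L : ℝ)⁻¹) := inv_nonneg.2 (Nat.cast_nonneg _)
    positivity
  have hΘBall := hΘrow F n K ε₀ hε0 hε1 U₀ hreg.1 hreg.2 c x 0 R (by rw [hx, B4Sect5Torus.tdist_self]; norm_num) (by omega) hroom'
  have hℓΘ : (F.L : ℝ) ^ (K - n) * Θ ≤ 4 * ε₀ * (3 + 2457 * C) := by rw [hΘdef]; exact ell_mul_theta_ball_le F n K hε0 hε1 hC0
  -- the η-GRADIENT LETTER `G := G_b + 2√2·(48ε₀)·M_u` on the `12ℓ+3`-ball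
  have hGb0 : 0 ≤ Gb := (norm_nonneg _).trans (hGb b (by rw [B3Taylor310LocalRemainder.tdist_self]; norm_num))
  set Gt : ℝ := Gb + 2 * Real.sqrt 2 * (48 * ε₀) * Mu with hGt
  have hGt0 : 0 ≤ Gt := by positivity
  have hGBall : ∀ (z : TSite 3 (periodsT3 F K)) (μ : Fin 3), tdist (periodsT3 F K) x z ≤ 12 * (F.L : ℝ) ^ (K - n) + 3 →
      (F.L : ℝ) ^ (K - n) * ‖WL2.equiv ℂ (fun _ : TSite 3 (periodsT3 F K) => c₀) W₂ (Φ u) (shift μ z) -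
        WL2.equiv ℂ (fun _ : TSite 3 (periodsT3 F K) => c₀) W₂ (Φ u) z‖ ≤ Gt := by
    intro z μ hz
    -- the covariant gradient at `(z, μ)` is the gauge-invariant `g(b′)`, `b′ = ⟨e⁻¹ z, μ⟩`
    have hcov : ‖WL2.equiv ℂ (fun _ : Bond 3 (periodsT3 F K) => c₀) W₂ (DL2 F n K c₀ V (Φ u)) (z, μ)‖ ≤ Gb := by
      rw [hV, hDpt]
      have hb' : bondEquiv F K (⟨(siteEquiv F K).symm z, μ⟩ : PBond (F.P K) 0) = (z, μ) := by
        simp [bondEquiv_apply]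
      have := hGb ⟨(siteEquiv F K).symm z, μ⟩ (tdist_iterBlockOf_le_of_ball F n K c z (by linarith only [hz]))
      rwa [hb'] at this
    have hz1 : tdist (periodsT3 F K) x (shift μ z) ≤ 12 * (F.L : ℝ) ^ (K - n) + 4 := by
      have h1 := tdist_triangle hP1 x z (shift μ z)
      have h2 := tdist_shift_le hP1 μ z
      linarith only [h1, h2, hz]
    have h1 := ell_mul_norm_sub_le_of_rows F n K c₀ V (Φ u) z μ hcov (hδBall z μ (by linarith only [hz])) (hMuBall _ hz1)
    calc _ ≤ Gb + 2 * Real.sqrt 2 * ((F.L : ℝ) ^ (K - n) * δ) * Mu := h1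
      _ ≤ Gb + 2 * Real.sqrt 2 * (48 * ε₀) * Mu :=
          add_le_add le_rfl (mul_le_mul_of_nonneg_right (mul_le_mul_of_nonneg_left hℓδ (by positivity : (0 : ℝ) ≤ 2 * Real.sqrt 2)) hMu0)
  -- (G1-3a) at `(V, Φu, Φ(q − f), 0, x)` with `M_f = H_f := 0`
  have h13 := hG13a F n K c₀ V (Φ u) (Φ (qp - fs)) 0 x Mu Gt 0 0 Mq δ Θ hMu0 hGt0 le_rfl le_rfl hMq0 hδ0 hΘ0 htrans
    (fun z hz => hMuBall z (by linarith only [hz, hℓ1])) hGBall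
    (fun z μ _ => by rw [WL2.equiv_zero, Pi.zero_apply, norm_zero])
    (fun z z' μ _ _ => by rw [WL2.equiv_zero, Pi.zero_apply, Pi.zero_apply, sub_self, norm_zero, zero_mul])
    (fun z hz => hMqBall z (by linarith only [hz, hℓ1])) (fun z μ hz => hδBall z μ (by linarith only [hz, hℓ1])) hΘBall b.dir
  -- read back `g(b) = ‖(D_V Φu)(x, b.dir)‖`
  have hread : ‖WL2.equiv ℂ (fun _ : Bond 3 (periodsT3 F K) => c₀) W₂ (DL2 F n K c₀ U₀ u) (bondEquiv F K b)‖
      ≤ (F.L : ℝ) ^ (K - n) * ‖WL2.equiv ℂ (fun _ : TSite 3 (periodsT3 F K) => c₀) W₂ (Φ u) (shift b.dir x) -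
          WL2.equiv ℂ (fun _ : TSite 3 (periodsT3 F K) => c₀) W₂ (Φ u) x‖ + 2 * Real.sqrt 2 * (48 * ε₀) * Mu := by
    have hb : bondEquiv F K b = (x, b.dir) := by rw [bondEquiv_apply]
    rw [hb, ← hDpt, ← hV]
    have hx0 : tdist (periodsT3 F K) x x ≤ 12 * (F.L : ℝ) ^ (K - n) + 4 := by rw [B4Sect5Torus.tdist_self]; positivity
    have hx1 : tdist (periodsT3 F K) x (shift b.dir x) ≤ 12 * (F.L : ℝ) ^ (K - n) + 4 := by
      have := tdist_shift_le hP1 b.dir x; linarith only [this, hℓ1]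
    have h1 := norm_DL2_le n V (Φ u) x b.dir
    have h2 : 2 * Real.sqrt 2 * ‖((bgOfCfg F K V (x, b.dir) : (Matrix (Fin 2) (Fin 2) ℂ)ˣ) : Matrix (Fin 2) (Fin 2) ℂ) - 1‖
        * ‖WL2.equiv ℂ (fun _ : TSite 3 (periodsT3 F K) => c₀) W₂ (Φ u) (shift b.dir x)‖ ≤ 2 * Real.sqrt 2 * δ * Mu :=
      mul_le_mul (mul_le_mul_of_nonneg_left (hδBall x b.dir hx0) (by positivity)) (hMuBall _ hx1) (norm_nonneg _) (by positivity)
    have h3 : (F.L : ℝ) ^ (K - n) * (2 * Real.sqrt 2 * δ * Mu) ≤ 2 * Real.sqrt 2 * (48 * ε₀) * Mu := by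
      have := mul_le_mul_of_nonneg_right (mul_le_mul_of_nonneg_left hℓδ (by positivity : (0 : ℝ) ≤ 2 * Real.sqrt 2)) hMu0
      calc (F.L : ℝ) ^ (K - n) * (2 * Real.sqrt 2 * δ * Mu) = 2 * Real.sqrt 2 * ((F.L : ℝ) ^ (K - n) * δ) * Mu := by ring
        _ ≤ _ := this
    calc _ ≤ (F.L : ℝ) ^ (K - n) * (‖WL2.equiv ℂ (fun _ : TSite 3 (periodsT3 F K) => c₀) W₂ (Φ u) (shift b.dir x) -
              WL2.equiv ℂ (fun _ : TSite 3 (periodsT3 F K) => c₀) W₂ (Φ u) x‖ + 2 * Real.sqrt 2 * δ * Mu) :=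
          h1.trans (mul_le_mul_of_nonneg_left (add_le_add le_rfl h2) hℓ0.le)
      _ = _ := mul_add _ _ _
      _ ≤ _ := add_le_add le_rfl h3
  -- the final regrouping: replace `ℓδ`, `ℓΘ` by their K-free envelopes and collect `G_b`
  have hkey := hread.trans (add_le_add h13 le_rfl)
  have hreg' := regroup_bracket (Cg := Cg) (Mu := Mu) (Mq := Mq) (Gb := Gb) hCg0 hMu0 hGb0 (mul_nonneg hℓ0.le hδ0) (mul_nonneg hℓ0.le hΘ0) hℓδ hℓΘ
  have hfin : Cg * (Mu + (0 + 2 * Real.sqrt 2 * ((F.L : ℝ) ^ (K - n) * Θ * Mu + (F.L : ℝ) ^ (K - n) * δ * (3 * Real.sqrt 10 * Gt)))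
        + (6 * Real.sqrt 2 * ((F.L : ℝ) ^ (K - n) * δ) * (0 + Gt + 2 * Real.sqrt 2 * ((F.L : ℝ) ^ (K - n) * δ) * Mu) + Mu + Mq))
      + 2 * Real.sqrt 2 * (48 * ε₀) * Mu
      ≤ (Cg * (Mu * (2 + 2 * Real.sqrt 2 * (4 * ε₀ * (3 + 2457 * C)) + (24 * Real.sqrt 10 + 48) * (48 * ε₀) ^ 2) + Mq) + 2 * Real.sqrt 2 * (48 * ε₀) * Mu)
        + Cg * ((48 * ε₀) * (6 * Real.sqrt 2 * Real.sqrt 10 + 6 * Real.sqrt 2)) * Gb := by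
    rw [hGt]
    exact hreg'
  refine (hkey.trans hfin).trans (le_of_eq ?_)
  rw [hMu, hMq]
  ring

/-! ## §2 ★★★ V6's `hDcol`, discharged -/

include h hε₀ hε1 hreg hseq hι hT hAG in
/-- ★★★ **THE CURVED MEMBER GRADIENT ROW — V6's `hDcol` BY TEXT** ([Balaban1985BackgroundPropagators] Thm 3.1 (3.43)–(3.44) for the LOD column at the curved background `U₀`, K-free).
Under `RegPr F n K ε₀ U₀` (`0 < ε₀ ≤ 1`), V6's LOD letters, the column's VALUE letters `hcol`∕`hpen`∕`hsrc` at a rate `κ ≥ 0`, the no-wrap room `2(12·L^{K−n} + 5) ≤ sitesPerDir 0` and the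
ABSORPTION MARGIN `C_g·(48ε₀(6√20 + 6√2))·e^{51κ} ≤ ½` (`C_g = (G1-3a)'s universal constant`): for all `y Y b`,
`‖(D_{U₀} G(T(ι(δ_y ⊗ Y))))(b)‖_{W₂} ≤ (2M)·e^{−κ·d(B b.src, y)}·‖Y‖`, `M` as in `perBond_gradient_le` — ✓`hDcol_of_perBond` with `(C_g, a, M, D) := (1, C_g·a₁, M, 51)`.
[cite: Balaban1985BackgroundPropagators, Thm 3.1 (3.42)–(3.44) pp.397–398, (3.45)–(3.47) p.398] -/
theorem column_gradient_decay {Cpt Apen Asrc κ : ℝ} (hCpt : 0 ≤ Cpt) (hApen : 0 ≤ Apen) (hAsrc : 0 ≤ Asrc) (hκ : 0 ≤ κ)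
    (hcol : ∀ (y : Site (F.P K) (K - n)) (Y : Matrix (Fin 2) (Fin 2) ℂ) (x : Site (F.P K) 0),
      ‖WL2.equiv ℂ _ W₂ (G (T (ι (Pi.single y Y)))) (siteEquiv F K x)‖ ≤ Cpt * Real.exp (-(κ * (Site.tdist (P := F.P K) (iterBlockOf (K - n) x) y : ℝ))) * ‖Y‖)
    (hpen : ∀ (y : Site (F.P K) (K - n)) (Y : Matrix (Fin 2) (Fin 2) ℂ) (x : Site (F.P K) 0),
      ‖WL2.equiv ℂ _ W₂ ((a : ℂ) • T (ι (Q'' (G (T (ι (Pi.single y Y))))))) (siteEquiv F K x)‖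
        ≤ Apen * Real.exp (-(κ * (Site.tdist (P := F.P K) (iterBlockOf (K - n) x) y : ℝ))) * ‖Y‖)
    (hsrc : ∀ (y : Site (F.P K) (K - n)) (Y : Matrix (Fin 2) (Fin 2) ℂ) (xt : TSite 3 (periodsT3 F K)),
      ‖WL2.equiv ℂ _ W₂ (T (ι (Pi.single y Y))) xt‖ ≤ Asrc * ‖Y‖)
    (hroom : 2 * (12 * F.L ^ (K - n) + 5) ≤ (F.P K).sitesPerDir 0)
    (hsmall : exists_curved_localGradient.choose * (48 * ε₀ * (6 * Real.sqrt 2 * Real.sqrt 10 + 6 * Real.sqrt 2)) * Real.exp (51 * κ) ≤ 1 / 2) :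
    ∀ (y : Site (F.P K) (K - n)) (Y : Matrix (Fin 2) (Fin 2) ℂ) (b : PBond (F.P K) 0),
      ‖WL2.equiv ℂ _ W₂ (DL2 F n K c₀ U₀ (G (T (ι (Pi.single y Y))))) (bondEquiv F K b)‖
        ≤ (2 * (exists_curved_localGradient.choose *
            (Cpt * Real.exp (51 * κ) * (2 + 2 * Real.sqrt 2 * (4 * ε₀ * (3 + 2457 * norm_bgOfCfg_axialT_sub_le.choose))
              + (24 * Real.sqrt 10 + 48) * (48 * ε₀) ^ 2) + (Apen + Asrc) * Real.exp (51 * κ))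
          + 2 * Real.sqrt 2 * (48 * ε₀) * (Cpt * Real.exp (51 * κ))))
          * Real.exp (-(κ * (Site.tdist (P := F.P K) (iterBlockOf (K - n) b.src) y : ℝ))) * ‖Y‖ := by
  have hCg0 : 0 ≤ exists_curved_localGradient.choose := exists_curved_localGradient.choose_spec.1
  set M : ℝ := exists_curved_localGradient.choose *
            (Cpt * Real.exp (51 * κ) * (2 + 2 * Real.sqrt 2 * (4 * ε₀ * (3 + 2457 * norm_bgOfCfg_axialT_sub_le.choose))
              + (24 * Real.sqrt 10 + 48) * (48 * ε₀) ^ 2) + (Apen + Asrc) * Real.exp (51 * κ))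
          + 2 * Real.sqrt 2 * (48 * ε₀) * (Cpt * Real.exp (51 * κ)) with hM
  have h := hDcol_of_perBond F c₀ U₀ ι T G
    (fun y Y b => M * ‖Y‖ * Real.exp (-(κ * (Site.tdist (P := F.P K) (iterBlockOf (K - n) b.src) y : ℝ))))
    (Cg := 1) (a := exists_curved_localGradient.choose * (48 * ε₀ * (6 * Real.sqrt 2 * Real.sqrt 10 + 6 * Real.sqrt 2))) (M := M) (κ := κ) (D := 51)
    hκ zero_le_one
    (fun y Y b Gb hGb => by
      rw [one_mul]
      exact perBond_gradient_le F h hε₀ hε1 U₀ hreg Q'' hseq ι hι T hT a G hAG hCpt hApen hAsrc hκ hcol hpen hsrc hroom y Y b Gb hGb)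
    (fun y Y b => le_rfl)
    (by rw [one_mul, mul_comm κ 51]; exact hsmall)
  intro y Y b
  have := h y Y b
  simpa only [mul_one] using this

end Summit.QuantumFields.YangMills.Theorems.Prop7CurvedMemberGradientRow

end
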